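import Mathlib

/-!
# `GrenetZeon.DualUnipotentThreeHalves` (stmt-ValiantsHypothesis-24318), R2 heavy-top instrument — toward the nil-index dimension bound:
# THE WALK-LEVEL COUNT for a digraph whose adjacency matrix is nilpotent of index `≤ k`

Experiment cell «val-heavytop-census» (D-0160), engine seat val-htc-eng-2 g3 (kernel-only lane).  Pure combinatorics used by
`…HeavyTopIndexCodim` (a nilpotent space `V ≤ M_n(ℂ)` with `Z^k = 0` on `V` has `dim V ≤ C(n,2) − (n − k)`; with the Q1 theorem
✓ `HeavyTopCodimOneReducible` this makes «irreducible nilpotent of codimension one ⇒ contains a regular nilpotent», i.e. `ι(s+1) ≤ C(s+1,2) − 2`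
hinges on Theorem C alone):

★ `card_add_le_choose_two_add` — let `S` be a set of ordered pairs on `Fin n` with at most one orientation per pair (`(a,b) ∈ S ⇒ (b,a) ∉ S`) whose
`0/1` adjacency matrix `M` satisfies `M^k = 0` over `ℕ` (no directed walk with `k` edges).  Then `#S + n ≤ C(n,2) + k`.
Proof: the LEVEL `lev v` = the largest `j < k` with a `j`-walk ending at `v` strictly increases along edges, so same-level pairs are non-edges;
`n` vertices in `k` levels leave at least `n − k` same-level unordered pairs (fibrewise `f(f−1) ≥ 2(f−1)`).

Honest framing: a counting lemma; nothing here proves or refutes `HeavyTopLaw`, 24318, S3 or 8062; `VP ≠ VNP` is NOT proved.  No definitions.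
[folklore (Gallai–Roy/Mirsky-type level argument); this seat]
-/

-- single-conjunct layout: Sub = Summit, duplicated namespace component intended
set_option linter.dupNamespace false

namespace Summit.ValiantsHypothesis.ValiantsHypothesis.Theorems.GrenetZeon.HeavyTopWalkLevelBound

open Finset Matrix

/-- `f² + 2 ≥ 3f` on `ℕ` (i.e. `(f−1)(f−2) ≥ 0`). [folklore] -/
theorem three_mul_le_sq_add_two (f : ℕ) : 3 * f ≤ f * f + 2 := by
  rcases f with _ | _ | _ | f
  · simp
  · simp
  · simp
  · nlinarith

/-- `2·C(n,2) = n·n − n`. [folklore] -/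
theorem two_mul_choose_two (n : ℕ) : 2 * n.choose 2 = n * n - n := by
  rw [Nat.choose_two_right, mul_comm 2, Nat.div_mul_cancel (Nat.even_mul_pred_self n).two_dvd, Nat.mul_sub_one]

/-- ★ **Walk-level count.**  `S` a set of ordered pairs on `Fin n` with at most one orientation per unordered pair, whose `0/1` adjacency matrix
has vanishing `k`-th power over `ℕ` (no directed `k`-edge walk).  Then `#S + n ≤ C(n,2) + k`. [folklore; this seat] -/
theorem card_add_le_choose_two_add {n : ℕ} (S : Finset (Fin n × Fin n)) (hanti : ∀ a b : Fin n, (a, b) ∈ S → (b, a) ∉ S) (k : ℕ)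
    (hk : (Matrix.of fun a b : Fin n => if (a, b) ∈ S then (1 : ℕ) else 0) ^ k = 0) :
    S.card + n ≤ n.choose 2 + k := by
  classical
  rcases Nat.eq_zero_or_pos n with hn | hn
  · subst hn
    have : S = ∅ := Finset.eq_empty_of_isEmpty S
    simp [this]
  set M : Matrix (Fin n) (Fin n) ℕ := Matrix.of fun a b : Fin n => if (a, b) ∈ S then (1 : ℕ) else 0 with hM
  have hk1 : 1 ≤ k := by
    rcases Nat.eq_zero_or_pos k with rfl | h
    · exfalso
      have := congrFun (congrFun hk ⟨0, hn⟩) ⟨0, hn⟩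
      simp at this
    · exact h
  have hMpow : ∀ j, k ≤ j → M ^ j = 0 := fun j hj => by
    rw [← Nat.add_sub_cancel' hj, pow_add, hk, zero_mul]
  -- the level of a vertex: the largest `j < k` with a `j`-walk ending there
  set lev : Fin n → ℕ := fun v => ((Finset.range k).filter (fun j => ∃ u, (M ^ j) u v ≠ 0)).sup id with hlev
  have hlev_lt : ∀ v, lev v < k := by
    intro v
    show ((Finset.range k).filter (fun j => ∃ u, (M ^ j) u v ≠ 0)).sup id < k
    rw [Finset.sup_lt_iff (show (⊥ : ℕ) < k from hk1)]
    intro j hj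
    exact Finset.mem_range.1 (Finset.mem_filter.1 hj).1
  have hlev_ge : ∀ v j, j < k → (∃ u, (M ^ j) u v ≠ 0) → j ≤ lev v := fun v j hj h => by
    show j ≤ ((Finset.range k).filter (fun j => ∃ u, (M ^ j) u v ≠ 0)).sup id
    exact Finset.le_sup (f := id) (Finset.mem_filter.2 ⟨Finset.mem_range.2 hj, h⟩)
  have hlev_wit : ∀ v, ∃ u, (M ^ (lev v)) u v ≠ 0 := by
    intro v
    have hne : ((Finset.range k).filter (fun j => ∃ u, (M ^ j) u v ≠ 0)).Nonempty :=
      ⟨0, Finset.mem_filter.2 ⟨Finset.mem_range.2 hk1, v, by simp⟩⟩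
    obtain ⟨j, hj, hjsup⟩ := Finset.exists_mem_eq_sup _ hne id
    have : lev v = j := hjsup
    rw [this]
    exact (Finset.mem_filter.1 hj).2
  -- edges raise the level
  have hedge : ∀ a b, (a, b) ∈ S → lev a + 1 ≤ lev b := by
    intro a b hab
    obtain ⟨u, hu⟩ := hlev_wit a
    have hpos : (M ^ (lev a + 1)) u b ≠ 0 := by
      rw [pow_succ, Matrix.mul_apply]
      intro h0
      have hle : (M ^ lev a) u a * M a b ≤ ∑ w, (M ^ lev a) u w * M w b :=
        Finset.single_le_sum (f := fun w => (M ^ lev a) u w * M w b) (fun w _ => Nat.zero_le _) (Finset.mem_univ a)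
      rw [h0] at hle
      have hMab : M a b = 1 := by simp [hM, hab]
      rw [hMab, mul_one] at hle
      exact hu (Nat.le_zero.1 hle)
    have hlt : lev a + 1 < k := by
      by_contra hge
      exact hpos (by rw [hMpow _ (not_lt.1 hge)]; rfl)
    exact hlev_ge b (lev a + 1) hlt ⟨u, hpos⟩
  have hirr : ∀ a, (a, a) ∉ S := fun a h => hanti a a h h
  -- counting ordered pairs
  set O : Finset (Fin n × Fin n) := (Finset.univ : Finset (Fin n)).offDiag with hO
  have hOcard : O.card = n * n - n := by rw [hO, Finset.offDiag_card, Finset.card_univ, Fintype.card_fin]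
  set D : Finset (Fin n × Fin n) := O.filter (fun p => ¬ lev p.1 = lev p.2) with hD
  set E : Finset (Fin n × Fin n) := O.filter (fun p => lev p.1 = lev p.2) with hE
  have hDE : E.card + D.card = O.card := Finset.card_filter_add_card_filter_not _
  -- both orientations of `S` lie in `D`
  have hS2 : (S ∪ S.image Prod.swap).card = 2 * S.card := by
    rw [Finset.card_union_of_disjoint, Finset.card_image_of_injective _ Prod.swap_injective, two_mul]
    rw [Finset.disjoint_left]
    rintro ⟨a, b⟩ hab hba
    obtain ⟨⟨b', a'⟩, hq, hq'⟩ := Finset.mem_image.1 hba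
    simp only [Prod.swap_prod_mk, Prod.mk.injEq] at hq'
    obtain ⟨rfl, rfl⟩ := hq'
    exact hanti _ _ hab hq
  have hS2D : S ∪ S.image Prod.swap ⊆ D := by
    intro p hp
    rcases Finset.mem_union.1 hp with h | h
    · obtain ⟨a, b⟩ := p
      have hab : a ≠ b := by rintro rfl; exact hirr _ h
      refine Finset.mem_filter.2 ⟨by simp [hO, Finset.mem_offDiag, hab], ?_⟩
      have := hedge a b h
      simp only
      omega
    · obtain ⟨⟨a, b⟩, hq, rfl⟩ := Finset.mem_image.1 h
      have hab : a ≠ b := by rintro rfl; exact hirr _ hq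
      refine Finset.mem_filter.2 ⟨by simp [hO, Finset.mem_offDiag, hab.symm], ?_⟩
      have := hedge a b hq
      simp only [Prod.swap_prod_mk]
      omega
  have h1 : 2 * S.card ≤ D.card := hS2 ▸ Finset.card_le_card hS2D
  -- same-level ordered pairs: at least `2(n − k)`
  have h2 : 2 * n ≤ E.card + 2 * k := by
    have hmaps : ((Finset.univ : Finset (Fin n)) : Set (Fin n)).MapsTo lev (Finset.range k : Finset ℕ) :=
      fun v _ => Finset.mem_coe.2 (Finset.mem_range.2 (hlev_lt v))
    have hn_sum : n = ∑ c ∈ Finset.range k, ((Finset.univ : Finset (Fin n)).filter (fun v => lev v = c)).card := by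
      have := Finset.card_eq_sum_card_fiberwise hmaps
      rwa [Finset.card_univ, Fintype.card_fin] at this
    have hmapsE : ((E : Finset (Fin n × Fin n)) : Set (Fin n × Fin n)).MapsTo (fun p => lev p.1) (Finset.range k : Finset ℕ) :=
      fun p _ => Finset.mem_coe.2 (Finset.mem_range.2 (hlev_lt p.1))
    have hE_sum : E.card = ∑ c ∈ Finset.range k, (E.filter (fun p => lev p.1 = c)).card := Finset.card_eq_sum_card_fiberwise hmapsE
    have hfib : ∀ c, E.filter (fun p => lev p.1 = c) = ((Finset.univ : Finset (Fin n)).filter (fun v => lev v = c)).offDiag := by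
      intro c
      ext ⟨a, b⟩
      simp only [hE, hO, Finset.mem_filter, Finset.mem_offDiag, Finset.mem_univ, true_and]
      constructor
      · rintro ⟨⟨hab, hl⟩, hc⟩; exact ⟨hc, hl ▸ hc, hab⟩
      · rintro ⟨ha, hb, hab⟩; exact ⟨⟨hab, ha.trans hb.symm⟩, ha⟩
    have key : ∑ c ∈ Finset.range k, 2 * ((Finset.univ : Finset (Fin n)).filter (fun v => lev v = c)).card ≤
        ∑ c ∈ Finset.range k, ((E.filter (fun p => lev p.1 = c)).card + 2) := by
      apply Finset.sum_le_sum
      intro c _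
      rw [hfib c, Finset.offDiag_card]
      have := three_mul_le_sq_add_two (((Finset.univ : Finset (Fin n)).filter (fun v => lev v = c)).card)
      have hle : ((Finset.univ : Finset (Fin n)).filter (fun v => lev v = c)).card ≤
          ((Finset.univ : Finset (Fin n)).filter (fun v => lev v = c)).card * ((Finset.univ : Finset (Fin n)).filter (fun v => lev v = c)).card :=
        Nat.le_mul_self _
      omega
    rw [← Finset.mul_sum, Finset.sum_add_distrib, Finset.sum_const, Finset.card_range, smul_eq_mul, ← hn_sum, ← hE_sum] at key
    omega
  have h3 := two_mul_choose_two n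
  omega

end Summit.ValiantsHypothesis.ValiantsHypothesis.Theorems.GrenetZeon.HeavyTopWalkLevelBound
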